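import Summits.AtomisticToContinuum.Crystallization.Theses.EnergyDerivativeOrder

/-!
# Route EnergyDerivativeOrder — `PositionalGlue` (item stmt-AtomisticToContinuum-14641)

The support-level glue `GappedKissingBound → LimitTransfer → PositionalTransfer`:
`LimitTransfer` is, by definition, `SpectralRigidityHcp → GappedKissingBound → C` where `C` is the
conclusion of `PositionalTransfer = SpectralRigidityHcp → C`; so feeding a proof of the gapped
kissing bound into the limit transfer discharges the positional crux. One line of logic.
-/

namespace Summit.AtomisticToContinuum.Crystallization.Theorems

open Summit.AtomisticToContinuum.Crystallization.Theses.EnergyDerivativeOrder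

/-- **Positional glue** (item stmt-AtomisticToContinuum-14641, route EnergyDerivativeOrder):
proofs of the gapped kissing bound `GappedKissingBound` and of the `GappedKissingBound`-fed limit
transfer `LimitTransfer` give the positional crux `PositionalTransfer` — pure logic, swapping the
order of the two antecedents of `LimitTransfer`. -/
theorem positionalGlue_proof :
    Summit.AtomisticToContinuum.Crystallization.Theses.EnergyDerivativeOrder.PositionalGlue := by
  unfold PositionalGlue
  intro hg hl h2
  exact hl h2 hg

end Summit.AtomisticToContinuum.Crystallization.Theorems
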